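import Literature.NumberTheory.NumberFields.RingClassFieldOfConductor
import Literature.NumberTheory.QuadraticFields.ConjugateIdealClass
import HarnessLib

/-!
# In a quadratic field the conjugate of a prime class of conductor `f` is its inverse
# (Cox, *Primes of the form x² + ny²*, §7.B and §9.A, proof of Lemma 9.3)

Topic `NumberTheory/QuadraticFields`.  Theorem-only file (no definition, no named fact, D-0026).
The conductor-`f` twin of `ConjugateIdealClass.lean` (`mk0_mul_mk0_smul_eq_one`, the class group
`Cl(𝓞_K)`), for the ring class group `I_K(f)/P_{K,ℤ}(f)` (`RingClassGroup K f`, classes `[𝔭]` =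
`RingClassField.primeClass f`, Cox §7.C).

Let `K` be a quadratic number field with non-trivial automorphism `τ`, `f` a natural number and
`𝔭 ∤ f` a prime of `𝓞_K`.  Then `[𝔭] · [τ𝔭] = 1` in `I_K(f)/P_{K,ℤ}(f)`
(`RingClass.primeClass_mul_primeClass_eq_one_of_smul`): with `(p) = 𝔭 ∩ ℤ` one has `p ∤ f`, the
primes above `p` are `𝔭` and `τ𝔭` (transitivity of `Gal(K/ℚ) = {1, τ}`) and `efg = 2`, so either
`p𝓞_K = 𝔭 · τ𝔭` or `p𝓞_K = 𝔭^e` with `e ∣ 2`; and `[p𝓞_K] = 1` because `p ∈ ℤ` is prime to `f`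
(`RingClassField.idealClass_span_eq_one`: the generators `α𝓞_K`, `α ≡ a (mod f𝓞_K)`, `a ∈ ℤ`
prime to `f`, of `P_{K,ℤ}(f)`).  This is the arithmetic input of Cox's Lemma 9.3 (the ring class
fields are generalised dihedral over `ℚ`: `RingClassFieldNormal.lean`): *"`𝔭𝔭̄ = N(𝔭)𝒪_K` … lies
in `P_{K,ℤ}(f)`"*.

* `RingClass.natCast_mem_smul_iff`, `RingClass.span_natCast_le_smul_iff` — bookkeeping
  (`𝔭 ∤ f ⟺ τ𝔭 ∤ f`);
* `RingClass.primeClass_mul_primeClass_eq_one_of_smul` — **`[𝔭] · [τ𝔭] = 1`**;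
* `RingClass.primeClass_eq_one_iff_of_smul` — `[τ𝔭] = 1 ↔ [𝔭] = 1` (any `τ ∈ Gal(K/ℚ)`).

presearch: Cox 2nd ed. §9.A proof of Lemma 9.3 (p. 181) — the printed statement being PROVED; tree
`lean search 'primeClass.*smul|smul.*primeClass'`: none; `mk0_mul_mk0_smul_eq_one` is the
`Cl(𝓞_K)` version (does not descend: `I_K(f)/P_{K,ℤ}(f) → Cl(𝓞_K)` is not injective).

## References

* D. A. Cox, *Primes of the form x² + ny²*, 2nd ed., Wiley (2013), §7.B, §7.C Prop. 7.22, §9.A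
  Lemma 9.3 (p. 181). [Cox2013]
* D. A. Marcus, *Number Fields*, 2nd ed. (2018), Ch. 3, Thm. 25 ff. [Marcus2018]
-/

noncomputable section

open NumberField IsDedekindDomain
open scoped nonZeroDivisors Pointwise

namespace Literature.NumberTheory.QuadraticFields

open Literature.NumberTheory.NumberFields Literature.NumberTheory.NumberFields.RingClassField
  Literature.NumberTheory.QuadraticFields.RingClass

variable {K : Type} [Field K] [NumberField K]

/-! ### In a quadratic field the conjugate of a prime class of conductor `f` is its inverse -/

/-- Equal ideals have equal classes in `I_K(f)/P_{K,ℤ}(f)` (proof-irrelevance helper; private —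
the same transport exists in a Summits-side tower file, not importable here). [folklore] -/
private theorem RingClass.idealClass_congr (f : ℕ) {I J : Ideal (𝓞 K)} (hIJ : I = J) (hI : I ≠ ⊥)
    (hIc : I ⊔ Ideal.span {(f : 𝓞 K)} = ⊤) (hJ : J ≠ ⊥) (hJc : J ⊔ Ideal.span {(f : 𝓞 K)} = ⊤) :
    idealClass f hI hIc = idealClass f hJ hJc := by
  subst hIJ
  rfl

/-- A natural number lies in the conjugate `τ • 𝔞` of an ideal iff it lies in `𝔞` (`τ` fixes `ℤ`;
the step "`τ` preserves the ideals prime to `f`" of Cox's proof of Lemma 9.3 / §7.C).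
[cite: Cox2013, §9.A Lemma 9.3 (proof) and §7.C (ideals prime to f)] -/
theorem RingClass.natCast_mem_smul_iff (τ : K ≃ₐ[ℚ] K) (I : Ideal (𝓞 K)) (f : ℕ) :
    (f : 𝓞 K) ∈ τ • I ↔ (f : 𝓞 K) ∈ I := by
  have hfix : τ⁻¹ • (f : 𝓞 K) = f :=
    map_natCast (MulSemiringAction.toRingHom (K ≃ₐ[ℚ] K) (𝓞 K) τ⁻¹) f
  rw [Ideal.mem_pointwise_smul_iff_inv_smul_mem, hfix]

/-- `𝔭 ∤ f` is preserved by conjugation: `f𝓞_K ≤ τ • 𝔭 ↔ f𝓞_K ≤ 𝔭` (Cox §7.C / proof of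
Lemma 9.3: conjugation maps `I_K(f)` to itself). [cite: Cox2013, §9.A Lemma 9.3 (proof) and §7.C (ideals prime to f)] -/
theorem RingClass.span_natCast_le_smul_iff (τ : K ≃ₐ[ℚ] K) (I : Ideal (𝓞 K)) (f : ℕ) :
    Ideal.span {(f : 𝓞 K)} ≤ τ • I ↔ Ideal.span {(f : 𝓞 K)} ≤ I := by
  rw [Ideal.span_singleton_le_iff_mem, Ideal.span_singleton_le_iff_mem,
    RingClass.natCast_mem_smul_iff]

/-- **In a quadratic field the conjugate of a prime class is its inverse, at conductor `f`**
(Cox §7.B / Lemma 9.3: "the class of the conjugate ideal is the inverse"; here in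
`I_K(f)/P_{K,ℤ}(f)`): for the non-trivial automorphism `τ` of a quadratic field `K`, a prime `𝔭 ∤ f`
and its conjugate `𝔭' = τ𝔭`, `[𝔭] · [𝔭'] = 1` in `I_K(f)/P_{K,ℤ}(f)`.  Proof: with `(p) = 𝔭 ∩ ℤ`,
`p ∤ f`, either `p𝓞_K = 𝔭 · τ𝔭` (`𝔭 ≠ τ𝔭`) or `p𝓞_K = 𝔭^e`, `e ∣ 2` (`𝔭 = τ𝔭`), and
`[p𝓞_K] = 1` because `p ∈ ℤ` is prime to `f` (`idealClass_span_eq_one`).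
[cite: Cox2013, §7.B and §9.A Lemma 9.3] [cite: Marcus2018, Ch. 3, Thm. 25] -/
theorem RingClass.primeClass_mul_primeClass_eq_one_of_smul (h2 : Module.finrank ℚ K = 2)
    (τ : K ≃ₐ[ℚ] K) (hτ : τ ≠ 1) (f : ℕ) {v w : HeightOneSpectrum (𝓞 K)}
    (hw : w.asIdeal = τ • v.asIdeal) (hv : ¬ Ideal.span {(f : 𝓞 K)} ≤ v.asIdeal) :
    primeClass f v * primeClass f w = 1 := by
  classical
  haveI : Algebra.IsQuadraticExtension ℚ K := ⟨h2⟩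
  haveI : IsGaloisGroup (K ≃ₐ[ℚ] K) ℤ (𝓞 K) :=
    IsGaloisGroup.of_isFractionRing (K ≃ₐ[ℚ] K) ℤ (𝓞 K) ℚ K
  have hG : Nat.card (K ≃ₐ[ℚ] K) = 2 := by rw [IsGalois.card_aut_eq_finrank, h2]
  -- coprimality of `𝔭`, `τ𝔭` with `f`
  have hvc : v.asIdeal ⊔ Ideal.span {(f : 𝓞 K)} = ⊤ := (sup_span_eq_top_iff_not_le f).mpr hv
  have hw' : ¬ Ideal.span {(f : 𝓞 K)} ≤ w.asIdeal := by
    rw [hw, RingClass.span_natCast_le_smul_iff]; exact hv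
  have hwc : w.asIdeal ⊔ Ideal.span {(f : 𝓞 K)} = ⊤ := (sup_span_eq_top_iff_not_le f).mpr hw'
  rw [primeClass_of_sup_eq_top f hvc, primeClass_of_sup_eq_top f hwc]
  -- the prime `p` of `ℤ` below `𝔭 = v.asIdeal`
  set P : Ideal (𝓞 K) := v.asIdeal with hPdef
  haveI := v.isMaximal
  set p : Ideal ℤ := P.under ℤ with hpdef
  haveI : p.IsMaximal := Ideal.IsMaximal.under ℤ P
  have hp0 : p ≠ ⊥ := mt Ideal.eq_bot_of_comap_eq_bot v.ne_bot
  have hPover : P ∈ p.primesOver (𝓞 K) := ⟨v.isPrime, ⟨rfl⟩⟩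
  -- a generator `p₀` of `p`, prime to `f`
  obtain ⟨p₀, hp₀⟩ := (IsPrincipalIdealRing.principal p).principal
  rw [Ideal.submodule_span_eq] at hp₀
  have hp₀0 : p₀ ≠ 0 := by
    intro h0; apply hp0; rw [hp₀, h0, Ideal.span_singleton_eq_bot.mpr rfl]
  have hp₀irr : Prime p₀ := (Ideal.span_singleton_prime hp₀0).mp (hp₀ ▸ (inferInstance : p.IsMaximal).isPrime)
  have hfp : ¬ p₀ ∣ (f : ℤ) := by
    intro hdvd
    apply hv
    rw [Ideal.span_singleton_le_iff_mem]
    have : (f : ℤ) ∈ p := by rw [hp₀]; exact Ideal.mem_span_singleton.mpr hdvd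
    rw [hpdef, Ideal.under_def, Ideal.mem_comap, map_natCast] at this
    exact this
  have hcop : IsCoprime p₀ (f : ℤ) := (Irreducible.coprime_iff_not_dvd hp₀irr.irreducible).mpr hfp
  -- `p𝓞_K = (p₀)` has trivial class
  have hmap : p.map (algebraMap ℤ (𝓞 K)) = Ideal.span {(p₀ : 𝓞 K)} := by
    rw [hp₀, Ideal.map_span, Set.image_singleton, eq_intCast]
  have hp₀K : (p₀ : 𝓞 K) ≠ 0 := by exact_mod_cast hp₀0
  have hIc : Ideal.span {(p₀ : 𝓞 K)} ⊔ Ideal.span {(f : 𝓞 K)} = ⊤ := by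
    rw [← Ideal.isCoprime_iff_sup_eq, Ideal.isCoprime_span_singleton_iff]
    obtain ⟨a, b, hab⟩ := hcop
    refine ⟨(a : 𝓞 K), (b : 𝓞 K), ?_⟩
    have := congrArg (fun z : ℤ => (z : 𝓞 K)) hab
    push_cast at this
    exact this
  have hI0 : Ideal.span {(p₀ : 𝓞 K)} ≠ ⊥ := by
    simpa [Ideal.span_singleton_eq_bot] using hp₀K
  have hprinc : idealClass f hI0 hIc = 1 :=
    idealClass_span_eq_one f hp₀K (a := p₀) hcop (by simp) hIc
  -- `e f g = 2` and the primes above `p` are `P`, `τ • P`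
  have hfac := Ideal.map_algebraMap_eq_finsetProd_pow (R := 𝓞 K) hp0
  have hefg :=
    Ideal.ncard_primesOver_mul_ramificationIdxIn_mul_inertiaDegIn p (𝓞 K) (K ≃ₐ[ℚ] K)
  rw [hG] at hefg
  have hein : ∀ Q ∈ p.primesOver (𝓞 K), Q.ramificationIdx ℤ = p.ramificationIdxIn (𝓞 K) := by
    intro Q hQ
    haveI := hQ.1
    haveI := hQ.2
    exact (Ideal.ramificationIdxIn_eq_ramificationIdx p Q (K ≃ₐ[ℚ] K)).symm
  have hconj : ∀ Q ∈ p.primesOver (𝓞 K), Q = P ∨ Q = τ • P := by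
    intro Q hQ
    haveI := hQ.1
    haveI := hQ.2
    haveI := hPover.2
    obtain ⟨σ, rfl⟩ := Ideal.exists_smul_eq_of_isGaloisGroup p P Q (K ≃ₐ[ℚ] K)
    rcases eq_one_or_eq_of_card_eq_two hG hτ σ with h | h
    · exact Or.inl (by rw [h, one_smul])
    · exact Or.inr (by rw [h])
  have hτP : τ • P ∈ p.primesOver (𝓞 K) := by
    have hprime : (τ • P).IsPrime := by
      haveI := v.isPrime
      exact Ideal.IsPrime.smul τ
    refine ⟨hprime, ⟨?_⟩⟩
    rw [Ideal.under_smul]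
  by_cases hfix : τ • P = P
  · -- `p 𝓞_K = P ^ e` with `e ∣ 2`
    have hset : p.primesOver (𝓞 K) = {P} := by
      ext Q
      simp only [Set.mem_singleton_iff]
      constructor
      · intro hQ
        rcases hconj Q hQ with h | h
        · exact h
        · rw [h, hfix]
      · rintro rfl
        exact hPover
    have hncard : (p.primesOver (𝓞 K)).ncard = 1 := by rw [hset, Set.ncard_singleton]
    rw [hncard, one_mul] at hefg
    have hedvd : P.ramificationIdx ℤ ∣ 2 := by
      rw [hein P hPover]
      exact Dvd.intro _ hefg
    have hfac' : p.map (algebraMap ℤ (𝓞 K)) = P ^ P.ramificationIdx ℤ := by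
      rw [hfac]
      simp only [hset, Set.toFinset_singleton, Finset.prod_singleton]
    have hwP : w.asIdeal = P := by rw [hw, hfix]
    rcases (Nat.dvd_prime Nat.prime_two).mp hedvd with h1 | h2'
    · -- `e = 1`: `P = (p₀)`, so `[P] = 1`
      rw [h1, pow_one] at hfac'
      have hPeq : P = Ideal.span {(p₀ : 𝓞 K)} := by rw [← hfac', hmap]
      have h1' : idealClass f v.ne_bot hvc = 1 := by
        rw [← hprinc]
        exact RingClass.idealClass_congr f hPeq _ _ _ _
      have h2'' : idealClass f w.ne_bot hwc = 1 := by
        rw [← hprinc]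
        exact RingClass.idealClass_congr f (hwP.trans hPeq) _ _ _ _
      rw [h1', h2'']
      exact one_mul (1 : RingClassGroup K f)
    · -- `e = 2`: `P * P = (p₀)`, so `[P]^2 = 1`
      rw [h2'] at hfac'
      have hPP : P * P = Ideal.span {(p₀ : 𝓞 K)} := by rw [← pow_two, ← hfac', hmap]
      have hPPc : P * P ⊔ Ideal.span {(f : 𝓞 K)} = ⊤ := by rw [hPP]; exact hIc
      have hmul := idealClass_mul f v.ne_bot v.ne_bot hvc hvc hPPc
      have h1' : idealClass f (mul_ne_zero v.ne_bot v.ne_bot) hPPc = 1 := by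
        rw [← hprinc]
        exact RingClass.idealClass_congr f hPP _ _ _ _
      have h2'' : idealClass f w.ne_bot hwc = idealClass f v.ne_bot hvc :=
        RingClass.idealClass_congr f hwP _ _ _ _
      rw [h2'', ← hmul, h1']
  · -- `p 𝓞_K = P · τP`, so `[P][τP] = [p 𝓞_K] = 1`
    have hne : P ≠ τ • P := fun h => hfix h.symm
    have hset : p.primesOver (𝓞 K) = {P, τ • P} := by
      symm
      refine Set.eq_of_subset_of_ncard_le ?_ ?_ (IsDedekindDomain.primesOver_finite p (𝓞 K))
      · intro Q hQ
        rcases hQ with rfl | rfl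
        · exact hPover
        · exact hτP
      · rw [Set.ncard_pair hne]
        have h1 : 1 ≤ p.ramificationIdxIn (𝓞 K) * p.inertiaDegIn (𝓞 K) :=
          Nat.one_le_iff_ne_zero.mpr (mul_ne_zero (Ideal.ramificationIdxIn_ne_zero (K ≃ₐ[ℚ] K))
            (Ideal.inertiaDegIn_ne_zero (K ≃ₐ[ℚ] K)))
        nlinarith [hefg, h1]
    have hncard : (p.primesOver (𝓞 K)).ncard = 2 := by rw [hset, Set.ncard_pair hne]
    rw [hncard] at hefg
    have he1 : p.ramificationIdxIn (𝓞 K) = 1 := by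
      have : p.ramificationIdxIn (𝓞 K) * p.inertiaDegIn (𝓞 K) = 1 := by omega
      exact Nat.eq_one_of_mul_eq_one_right this
    have hfac' : p.map (algebraMap ℤ (𝓞 K)) = P * τ • P := by
      rw [hfac]
      simp only [hset, Set.toFinset_insert, Set.toFinset_singleton]
      rw [Finset.prod_insert (by simpa using hne), Finset.prod_singleton, hein P hPover,
        hein (τ • P) hτP, he1, pow_one, pow_one]
    have hPP : P * τ • P = Ideal.span {(p₀ : 𝓞 K)} := by rw [← hfac', hmap]
    have hτP0 : τ • P ≠ ⊥ := by rw [← hw]; exact w.ne_bot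
    have hτPc : τ • P ⊔ Ideal.span {(f : 𝓞 K)} = ⊤ := by rw [← hw]; exact hwc
    have hPPc : P * τ • P ⊔ Ideal.span {(f : 𝓞 K)} = ⊤ := by rw [hPP]; exact hIc
    have hmul := idealClass_mul f v.ne_bot hτP0 hvc hτPc hPPc
    have h1' : idealClass f (mul_ne_zero v.ne_bot hτP0) hPPc = 1 := by
      rw [← hprinc]
      exact RingClass.idealClass_congr f hPP _ _ _ _
    have h2'' : idealClass f w.ne_bot hwc = idealClass f hτP0 hτPc :=
      RingClass.idealClass_congr f hw _ _ _ _
    rw [h2'', ← hmul, h1']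

/-- `[τ𝔭] = 1 ↔ [𝔭] = 1` in `I_K(f)/P_{K,ℤ}(f)` for a quadratic `K`, `τ ∈ Gal(K/ℚ)`, `𝔭 ∤ f`
(trivially for `τ = 1`; by `RingClass.primeClass_mul_primeClass_eq_one_of_smul` otherwise).
[cite: Cox2013, §9.A Lemma 9.3] -/
theorem RingClass.primeClass_eq_one_iff_of_smul (h2 : Module.finrank ℚ K = 2) (τ : K ≃ₐ[ℚ] K)
    (f : ℕ) {v w : HeightOneSpectrum (𝓞 K)} (hw : w.asIdeal = τ • v.asIdeal)
    (hv : ¬ Ideal.span {(f : 𝓞 K)} ≤ v.asIdeal) :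
    primeClass f w = 1 ↔ primeClass f v = 1 := by
  by_cases hτ : τ = 1
  · subst hτ
    rw [one_smul] at hw
    rw [HeightOneSpectrum.ext hw]
  · have h : primeClass f w = (primeClass f v)⁻¹ :=
      eq_inv_of_mul_eq_one_right (RingClass.primeClass_mul_primeClass_eq_one_of_smul h2 τ hτ f hw hv)
    rw [h, inv_eq_one]

end Literature.NumberTheory.QuadraticFields

end
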